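import Literature.AlgebraicGeometry.Motives.UniversalHypersurfaceRegularLocusSubmersion
import Literature.AlgebraicGeometry.Motives.UniversalHypersurfaceRegularLocusTopology
import Literature.Geometry.Manifold.TranslationFlowLocal
import HarnessLib

/-!
# Coefficients along the orbits of cut-off lifted fields on `𝒴°(ℂ)`

Family `hodge`, layer `Literature/AlgebraicGeometry/Motives`; step A2a of the programme discharging
`HodgeTheory/CyclicCoverNodalMeridianLocalMonodromyBound`. For a vector field `X` on `𝒴°(ℂ)` lifting a field `W` of the coefficient space
(`db(X) = W ∘ b`, `UniversalHypersurfaceRegularLocusLift`) and a scalar cut-off `f`, the field `f • X` lifts `f·(W ∘ b)`; a coefficient `b_m`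
on which `W` has no component is CONSTANT along every integral curve of `f • X`, and where `f ≡ 1` and `W` has constant `m`-component `c` the
coefficient `b_m` moves by translation (`Geometry/Manifold/TranslationFlowLocal`).

* `mfderiv_regCoeff_smul` — `db(f • X) = f • W(b)`;
* `mfderiv_regCoeff_apply` — the `m`-th coefficient has derivative the `m`-component;
* `regCoeff_apply_integralCurve_const` — **`b_m` is constant along integral curves of `f • X` when `(W b)_m = 0` for all `b`**;
* `regCoeff_apply_integralCurve_eq_add` — **`b_m(γ t) = b_m(γ t₀) + (t − t₀)·c` while `γ` stays in a region where `f = 1` and `(W b)_m = c`.**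

Everything is proved; no definitions, no named facts.

## References

* [BrockerJanichIDT1982] T. Bröcker, K. Jänich, Introduction to Differential Topology (1982), (8.12) (proof: flows of lifted basic fields).
-/

noncomputable section

open CategoryTheory AlgebraicGeometry TopologicalSpace Set Topology
open scoped Manifold ContDiff
open Literature.Geometry.Manifold

namespace Literature.AlgebraicGeometry.Motives.UniversalHypersurface

variable (n d : ℕ)

-- the tangent spaces of the model vector spaces are the spaces themselves
set_option backward.isDefEq.respectTransparency false in
/-- **`db(f • X) = f • W(b)`** when `db(X) = W ∘ b`. [cite: BrockerJanichIDT1982, (8.12)] -/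
theorem mfderiv_regCoeff_smul (hd : 0 < d)
    (X : haveI := locallyOfFiniteType_regularTotal_hom ℂ n d hd
      haveI := smoothOfRelativeDimension_regularTotal_hom ℂ n d hd
      letI := ComplexPoints.chartedSpace (regularTotal ℂ n d) (n + Fintype.card (DegIndex n d))
      Π Q : ComplexPoints (regularTotal ℂ n d), TangentSpace (𝓡 (2 * (n + Fintype.card (DegIndex n d)))) Q)
    (f : ComplexPoints (regularTotal ℂ n d) → ℝ) {W : (DegIndex n d → ℂ) → (DegIndex n d → ℂ)}
    (hXW : haveI := locallyOfFiniteType_regularTotal_hom ℂ n d hd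
      haveI := smoothOfRelativeDimension_regularTotal_hom ℂ n d hd
      letI := ComplexPoints.chartedSpace (regularTotal ℂ n d) (n + Fintype.card (DegIndex n d))
      ∀ Q, mfderiv (𝓡 (2 * (n + Fintype.card (DegIndex n d)))) 𝓘(ℝ, DegIndex n d → ℂ) (fun Q' => regCoeff ℂ n d Q') Q (X Q) =
        W (regCoeff ℂ n d Q))
    (Q : ComplexPoints (regularTotal ℂ n d)) :
    haveI := locallyOfFiniteType_regularTotal_hom ℂ n d hd
    haveI := smoothOfRelativeDimension_regularTotal_hom ℂ n d hd
    letI := ComplexPoints.chartedSpace (regularTotal ℂ n d) (n + Fintype.card (DegIndex n d))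
    mfderiv (𝓡 (2 * (n + Fintype.card (DegIndex n d)))) 𝓘(ℝ, DegIndex n d → ℂ) (fun Q' => regCoeff ℂ n d Q') Q (f Q • X Q) =
      f Q • W (regCoeff ℂ n d Q) := by
  rw [map_smul, hXW Q]

-- the tangent spaces of the model vector spaces are the spaces themselves
set_option backward.isDefEq.respectTransparency false in
/-- **The `m`-th coefficient has derivative the `m`-component of `db`.** [cite: BrockerJanichIDT1982, (8.12)] -/
theorem mfderiv_regCoeff_apply (hd : 0 < d) (m : DegIndex n d) (Q : ComplexPoints (regularTotal ℂ n d))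
    (v : haveI := locallyOfFiniteType_regularTotal_hom ℂ n d hd
      haveI := smoothOfRelativeDimension_regularTotal_hom ℂ n d hd
      letI := ComplexPoints.chartedSpace (regularTotal ℂ n d) (n + Fintype.card (DegIndex n d))
      TangentSpace (𝓡 (2 * (n + Fintype.card (DegIndex n d)))) Q) :
    haveI := locallyOfFiniteType_regularTotal_hom ℂ n d hd
    haveI := smoothOfRelativeDimension_regularTotal_hom ℂ n d hd
    letI := ComplexPoints.chartedSpace (regularTotal ℂ n d) (n + Fintype.card (DegIndex n d))
    mfderiv (𝓡 (2 * (n + Fintype.card (DegIndex n d)))) 𝓘(ℝ, ℂ) (fun Q' => regCoeff ℂ n d Q' m) Q v =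
      (mfderiv (𝓡 (2 * (n + Fintype.card (DegIndex n d)))) 𝓘(ℝ, DegIndex n d → ℂ) (fun Q' => regCoeff ℂ n d Q') Q v) m := by
  haveI := locallyOfFiniteType_regularTotal_hom ℂ n d hd
  haveI := smoothOfRelativeDimension_regularTotal_hom ℂ n d hd
  letI := ComplexPoints.chartedSpace (regularTotal ℂ n d) (n + Fintype.card (DegIndex n d))
  haveI := ComplexPoints.isManifold_real (regularTotal ℂ n d) (n + Fintype.card (DegIndex n d))
  have hg : MDifferentiableAt (𝓡 (2 * (n + Fintype.card (DegIndex n d)))) 𝓘(ℝ, DegIndex n d → ℂ)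
      (fun Q' => regCoeff ℂ n d Q') Q := (contMDiffAt_regCoeff n d hd Q).mdifferentiableAt (by simp)
  have hproj : (fun Q' => regCoeff ℂ n d Q' m) =
      (ContinuousLinearMap.proj (R := ℝ) m : (DegIndex n d → ℂ) →L[ℝ] ℂ) ∘ fun Q' => regCoeff ℂ n d Q' := rfl
  rw [hproj, mfderiv_comp Q (ContinuousLinearMap.proj (R := ℝ) m).mdifferentiableAt hg, ContinuousLinearMap.mfderiv_eq]
  rfl

-- the tangent spaces of the model vector spaces are the spaces themselves
set_option backward.isDefEq.respectTransparency false in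
/-- **A coefficient on which `W` has no component is conserved along the orbits of `f • X`.** [cite: BrockerJanichIDT1982, (8.12) (proof)] -/
theorem regCoeff_apply_integralCurve_const (hd : 0 < d)
    (X : haveI := locallyOfFiniteType_regularTotal_hom ℂ n d hd
      haveI := smoothOfRelativeDimension_regularTotal_hom ℂ n d hd
      letI := ComplexPoints.chartedSpace (regularTotal ℂ n d) (n + Fintype.card (DegIndex n d))
      Π Q : ComplexPoints (regularTotal ℂ n d), TangentSpace (𝓡 (2 * (n + Fintype.card (DegIndex n d)))) Q)
    (f : ComplexPoints (regularTotal ℂ n d) → ℝ) {W : (DegIndex n d → ℂ) → (DegIndex n d → ℂ)}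
    (hXW : haveI := locallyOfFiniteType_regularTotal_hom ℂ n d hd
      haveI := smoothOfRelativeDimension_regularTotal_hom ℂ n d hd
      letI := ComplexPoints.chartedSpace (regularTotal ℂ n d) (n + Fintype.card (DegIndex n d))
      ∀ Q, mfderiv (𝓡 (2 * (n + Fintype.card (DegIndex n d)))) 𝓘(ℝ, DegIndex n d → ℂ) (fun Q' => regCoeff ℂ n d Q') Q (X Q) =
        W (regCoeff ℂ n d Q))
    {m : DegIndex n d} (hWm : ∀ b, W b m = 0)
    {γ : ℝ → ComplexPoints (regularTotal ℂ n d)}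
    (hγ : haveI := locallyOfFiniteType_regularTotal_hom ℂ n d hd
      haveI := smoothOfRelativeDimension_regularTotal_hom ℂ n d hd
      letI := ComplexPoints.chartedSpace (regularTotal ℂ n d) (n + Fintype.card (DegIndex n d))
      IsMIntegralCurve γ (fun Q' => f Q' • X Q')) (t₀ t : ℝ) :
    regCoeff ℂ n d (γ t) m = regCoeff ℂ n d (γ t₀) m := by
  haveI := locallyOfFiniteType_regularTotal_hom ℂ n d hd
  haveI := smoothOfRelativeDimension_regularTotal_hom ℂ n d hd
  letI := ComplexPoints.chartedSpace (regularTotal ℂ n d) (n + Fintype.card (DegIndex n d))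
  haveI := ComplexPoints.isManifold_real (regularTotal ℂ n d) (n + Fintype.card (DegIndex n d))
  have hg : ContMDiff (𝓡 (2 * (n + Fintype.card (DegIndex n d)))) 𝓘(ℝ, ℂ) 1 (fun Q' => regCoeff ℂ n d Q' m) :=
    fun Q => ((ContinuousLinearMap.proj (R := ℝ) m : (DegIndex n d → ℂ) →L[ℝ] ℂ).contMDiff.comp
      (fun Q' => contMDiffAt_regCoeff n d hd Q') Q).of_le (by simp)
  have hc : ∀ Q ∈ (Set.univ : Set (ComplexPoints (regularTotal ℂ n d))),
      mfderiv (𝓡 (2 * (n + Fintype.card (DegIndex n d)))) 𝓘(ℝ, ℂ) (fun Q' => regCoeff ℂ n d Q' m) Q (f Q • X Q) = (0 : ℂ) := by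
    intro Q _
    rw [mfderiv_regCoeff_apply n d hd m Q, mfderiv_regCoeff_smul n d hd X f hXW Q, Pi.smul_apply, hWm, smul_zero]
  have h := apply_integralCurve_eq_add_smul_of_mapsTo (I := 𝓡 (2 * (n + Fintype.card (DegIndex n d)))) hg hc isOpen_univ
    Set.ordConnected_univ (hγ.isMIntegralCurveOn _) (Set.mapsTo_univ _ _) (Set.mem_univ t₀) (Set.mem_univ t)
  rw [h, smul_zero, add_zero]

-- the tangent spaces of the model vector spaces are the spaces themselves
set_option backward.isDefEq.respectTransparency false in
/-- **Translation of a coefficient in a region where the cut-off is `1` and `W` has constant `m`-component**: if `f = 1` and `(W (b Q))_m = c`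
for `Q ∈ C`, and the integral curve `γ` of `f • X` stays in `C` on an open interval `J`, then `b_m(γ t) = b_m(γ t₀) + (t − t₀)·c` on `J`.
[cite: BrockerJanichIDT1982, (8.12) (proof)] -/
theorem regCoeff_apply_integralCurve_eq_add (hd : 0 < d)
    (X : haveI := locallyOfFiniteType_regularTotal_hom ℂ n d hd
      haveI := smoothOfRelativeDimension_regularTotal_hom ℂ n d hd
      letI := ComplexPoints.chartedSpace (regularTotal ℂ n d) (n + Fintype.card (DegIndex n d))
      Π Q : ComplexPoints (regularTotal ℂ n d), TangentSpace (𝓡 (2 * (n + Fintype.card (DegIndex n d)))) Q)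
    (f : ComplexPoints (regularTotal ℂ n d) → ℝ) {W : (DegIndex n d → ℂ) → (DegIndex n d → ℂ)}
    (hXW : haveI := locallyOfFiniteType_regularTotal_hom ℂ n d hd
      haveI := smoothOfRelativeDimension_regularTotal_hom ℂ n d hd
      letI := ComplexPoints.chartedSpace (regularTotal ℂ n d) (n + Fintype.card (DegIndex n d))
      ∀ Q, mfderiv (𝓡 (2 * (n + Fintype.card (DegIndex n d)))) 𝓘(ℝ, DegIndex n d → ℂ) (fun Q' => regCoeff ℂ n d Q') Q (X Q) =
        W (regCoeff ℂ n d Q))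
    {m : DegIndex n d} {c : ℂ} {C : Set (ComplexPoints (regularTotal ℂ n d))}
    (hfC : ∀ Q ∈ C, f Q = 1) (hWC : ∀ Q ∈ C, W (regCoeff ℂ n d Q) m = c)
    {γ : ℝ → ComplexPoints (regularTotal ℂ n d)} {J : Set ℝ} (hJ : IsOpen J) (hJc : J.OrdConnected)
    (hγ : haveI := locallyOfFiniteType_regularTotal_hom ℂ n d hd
      haveI := smoothOfRelativeDimension_regularTotal_hom ℂ n d hd
      letI := ComplexPoints.chartedSpace (regularTotal ℂ n d) (n + Fintype.card (DegIndex n d))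
      IsMIntegralCurveOn γ (fun Q' => f Q' • X Q') J)
    (hγC : Set.MapsTo γ J C) {t₀ t : ℝ} (ht₀ : t₀ ∈ J) (ht : t ∈ J) :
    regCoeff ℂ n d (γ t) m = regCoeff ℂ n d (γ t₀) m + (t - t₀) • c := by
  haveI := locallyOfFiniteType_regularTotal_hom ℂ n d hd
  haveI := smoothOfRelativeDimension_regularTotal_hom ℂ n d hd
  letI := ComplexPoints.chartedSpace (regularTotal ℂ n d) (n + Fintype.card (DegIndex n d))
  haveI := ComplexPoints.isManifold_real (regularTotal ℂ n d) (n + Fintype.card (DegIndex n d))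
  have hg : ContMDiff (𝓡 (2 * (n + Fintype.card (DegIndex n d)))) 𝓘(ℝ, ℂ) 1 (fun Q' => regCoeff ℂ n d Q' m) :=
    fun Q => ((ContinuousLinearMap.proj (R := ℝ) m : (DegIndex n d → ℂ) →L[ℝ] ℂ).contMDiff.comp
      (fun Q' => contMDiffAt_regCoeff n d hd Q') Q).of_le (by simp)
  have hc : ∀ Q ∈ C,
      mfderiv (𝓡 (2 * (n + Fintype.card (DegIndex n d)))) 𝓘(ℝ, ℂ) (fun Q' => regCoeff ℂ n d Q' m) Q (f Q • X Q) = c := by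
    intro Q hQ
    rw [mfderiv_regCoeff_apply n d hd m Q, mfderiv_regCoeff_smul n d hd X f hXW Q, Pi.smul_apply, hfC Q hQ, one_smul, hWC Q hQ]
  exact apply_integralCurve_eq_add_smul_of_mapsTo (I := 𝓡 (2 * (n + Fintype.card (DegIndex n d)))) hg hc hJ hJc hγ hγC ht₀ ht

end Literature.AlgebraicGeometry.Motives.UniversalHypersurface

end
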